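import Literature.Probability.LatticeModels.FatRectangleBoxes
import HarnessLib

/-!
# The scale step of [Mar99] Theorem 4.5 on fat rectangles, PROVED (explicit-parameter form)

Topic `Literature/Probability/LatticeModels`; cell `ym-ir`, seat lit-3 (census rows B2/B4).  Theorems only
(D-0026).  [Mar99] Theorem 4.5, proof p0188 L36 – p0190 L16 ((4.14)–(4.19)), in the language of the typed fact
`Glauber.Martinelli1999_thm4_5` (`d = 2`, `𝓡_L = fatRectangles L`, `SMT` on all fat rectangles):
* `Glauber.poincareIneq_box_of_halves_fat` — the two-block step `poincareIneq_box_of_halves` with the `SMT`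
  input taken from FAT RECTANGLES (the `ρ`-boxes inside the overlap strips are fat for `ρ ≥ 2r`) and the
  error uniformised through a bound `M` on the volume.
* `Glauber.fatRectangles_poincare_step` — (4.16)–(4.19) in one statement: if every `R ∈ 𝓡_{L'}` has
  `gap ≥ g` (all boundary conditions), then every `R ∈ 𝓡_{L''}`, `3L'' ≤ 4L'`, has `gap ≥ θ² g`,
  `θ = (1 − √(κ̄/(1−κ̄))) · N/(N+1)`, for any admissible parameters `(δ, ρ, N)` at scale `L'` (overlap width
  `δ ≥ ρ + r`, `N` strips, `12(Nδ + δ) ≤ L'`, `10(ρ+1) ≤ L'`) and `κ̄ < ½` the explicit two-block error at volume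
  `M = 4L'²`.  Rectangles longer than `L'` in one direction are halved along it ((4.16), case a)); those longer
  in both directions are halved twice (case b) p0189 L32–34 and (4.18)); halving along the LONGEST side keeps
  fatness.  What remains for the typed fact: the choice `δ = ⌊√L⌋`, `ρ = δ − r`, `N = ⌊L/(12δ)⌋`, the
  verification `κ̄(L) < ½ ∧ √(κ̄/(1−κ̄)) ≤ 1/√L` for `L ≥ L₁` (super-polynomial smallness), three iterations
  `L → 4L/3 → 16L/9 → 64L/27 ⊇ 2L`, and `inf_L g(L) > 0` (infinite product + Theorem 3.8 at the base scale).
SIBLING-SETTING result (`±1` spins, range `r`); the Yang–Mills gap is not touched.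
[cite: Martinelli1999, Theorem 4.5, proof, (4.16)–(4.19)]
-/

open MeasureTheory ProbabilityTheory Finset Filter

noncomputable section

namespace Literature.Probability.LatticeModels

namespace Glauber

variable {r : ℕ} (U : FRPotential 2 ℤˣ r) (β : ℝ)

/-- `κ ↦ κ/(1−κ)` is monotone on `[0,1)`. [folklore] -/
private theorem div_one_sub_le_div_one_sub' {x y : ℝ} (hxy : x ≤ y) (hy : y < 1) :
    x / (1 - x) ≤ y / (1 - y) := by
  rw [div_le_div_iff₀ (by linarith) (by linarith)]
  nlinarith

set_option maxHeartbeats 1600000 in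
/-- **The two-block step with fat-rectangle `SMT`** ([Mar99] Theorem 4.5, proof, (4.14)–(4.16)): as
`poincareIneq_box_of_halves` (`d = 2`), with `SMT(·, l, m)` assumed on all fat rectangles (the `ρ`-boxes used
inside the overlap strips have sides in `[ρ+1−r, 2ρ+1]`, fat for `ρ ≥ 2r`) and the error uniformised through
a bound `M ≥ |Q|`. [cite: Martinelli1999, Theorem 4.5, proof, (4.16)] -/
theorem poincareIneq_box_of_halves_fat {R : ℝ} (hR1 : 1 ≤ R)
    (hR : ∀ (Λ : Finset (Site 2)) (y : Site 2) (σ : Site 2 → ℤˣ),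
      R⁻¹ ≤ flipWeight U β Λ y σ ∧ flipWeight U β Λ y σ ≤ R)
    {lS : ℕ} {m : ℝ} (hm : 0 < m) (hSMT : ∀ L : ℕ, ∀ Q ∈ fatRectangles L, SMT (U.spec β) Q lS m)
    {a b : Site 2} {j : Fin 2} {c : ℤ} {δ N ρ : ℕ} (hN : 0 < N) (hδ0 : 0 < δ) (hc : a j ≤ c)
    (hend : c + N * δ + δ ≤ b j) (hρ2 : 2 * r ≤ ρ) (hρδ : ρ + r ≤ δ) (hρl : lS + 2 * r ≤ ρ)
    (hwide : ∀ i, i ≠ j → (ρ : ℤ) + 1 ≤ b i - a i)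
    {M : ℕ} (hM : ((Fintype.piFinset fun i => Finset.Ico ((a) i) ((b) i))).card ≤ M) {κ : ℝ}
    (hκdef : κ = (1 + R ^ 6 * (2 * r + 1 : ℝ) ^ 2 * (2 * r + 1 : ℝ) ^ 2 * M *
        ((2 * (ρ + r) + 1) ^ 2 : ℕ) * Real.exp (-(m * ((ρ : ℝ) - 2 * r)))) ^ M - 1)
    (hκ : κ < 1 / 2) {g : ℝ} (hg : 0 ≤ g)
    (hTop : ∀ n : ℕ, n < N → ∀ φ : Site 2 → ℤˣ,
      PoincareIneq (U.spec β (Fintype.piFinset fun i => Finset.Ico ((Function.update a j (c + n * δ)) i) ((b) i)) φ) (Fintype.piFinset fun i => Finset.Ico ((Function.update a j (c + n * δ)) i) ((b) i)) g)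
    (hBot : ∀ n : ℕ, n < N → ∀ φ : Site 2 → ℤˣ,
      PoincareIneq (U.spec β (Fintype.piFinset fun i => Finset.Ico ((a) i) ((Function.update b j (c + n * δ + δ)) i)) φ)
        (Fintype.piFinset fun i => Finset.Ico ((a) i) ((Function.update b j (c + n * δ + δ)) i)) g)
    (τ : Site 2 → ℤˣ) :
    PoincareIneq (U.spec β (Fintype.piFinset fun i => Finset.Ico ((a) i) ((b) i)) τ) (Fintype.piFinset fun i => Finset.Ico ((a) i) ((b) i)) ((1 - Real.sqrt (κ / (1 - κ))) * g * N / (N + 1)) := by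
  classical
  -- the `SMT` input on ρ-boxes
  have hρr : r ≤ ρ := by omega
  have hSMT' : ∀ a' b' : Site 2, (∀ i, (ρ : ℤ) + 1 - r ≤ b' i - a' i ∧ b' i - a' i ≤ 2 * ρ + 1) →
      SMT (U.spec β) (Fintype.piFinset fun i => Finset.Ico ((a') i) ((b') i)) lS m := by
    intro a' b' h
    refine hSMT (2 * ρ + 1) _ (IcoBox_mem_fatRectangles (fun i => ?_) (fun i i' => ?_) (fun i => ?_))
    · have := (h i).1
      have hρr' : (r : ℤ) ≤ ρ := by exact_mod_cast hρr
      linarith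
    · have h1 := (h i).2
      have h2 := (h i').1
      have hρ2' : (2 * r : ℤ) ≤ ρ := by exact_mod_cast hρ2
      nlinarith
    · have := (h i).2
      push_cast
      linarith
  -- the error of this box is at most `κ`
  set κQ := (1 + R ^ 6 * (2 * r + 1 : ℝ) ^ 2 * (2 * r + 1 : ℝ) ^ 2 * ((Fintype.piFinset fun i => Finset.Ico ((a) i) ((b) i))).card *
      ((2 * (ρ + r) + 1) ^ 2 : ℕ) * Real.exp (-(m * ((ρ : ℝ) - 2 * r)))) ^ ((Fintype.piFinset fun i => Finset.Ico ((a) i) ((b) i))).card - 1 with hκQ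
  have hκQκ : κQ ≤ κ := by
    rw [hκQ, hκdef]
    refine sub_le_sub_right ?_ 1
    set α : ℝ := R ^ 6 * (2 * r + 1 : ℝ) ^ 2 * (2 * r + 1 : ℝ) ^ 2 with hα
    set e : ℝ := ((2 * (ρ + r) + 1) ^ 2 : ℕ) * Real.exp (-(m * ((ρ : ℝ) - 2 * r))) with he
    have hMc : ((((Fintype.piFinset fun i => Finset.Ico ((a) i) ((b) i))).card : ℕ) : ℝ) ≤ M := by exact_mod_cast hM
    have h1 : (1 : ℝ) + α * ((Fintype.piFinset fun i => Finset.Ico ((a) i) ((b) i))).card * ((2 * (ρ + r) + 1) ^ 2 : ℕ) * Real.exp (-(m * ((ρ : ℝ) - 2 * r)))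
        ≤ 1 + α * M * ((2 * (ρ + r) + 1) ^ 2 : ℕ) * Real.exp (-(m * ((ρ : ℝ) - 2 * r))) := by
      have : α * (((Fintype.piFinset fun i => Finset.Ico ((a) i) ((b) i))).card : ℝ) * e ≤ α * M * e := by gcongr
      rw [he] at this; nlinarith [this]
    calc (1 + α * ((Fintype.piFinset fun i => Finset.Ico ((a) i) ((b) i))).card * ((2 * (ρ + r) + 1) ^ 2 : ℕ) * Real.exp (-(m * ((ρ : ℝ) - 2 * r)))) ^
          ((Fintype.piFinset fun i => Finset.Ico ((a) i) ((b) i))).card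
        ≤ (1 + α * M * ((2 * (ρ + r) + 1) ^ 2 : ℕ) * Real.exp (-(m * ((ρ : ℝ) - 2 * r)))) ^ ((Fintype.piFinset fun i => Finset.Ico ((a) i) ((b) i))).card :=
          pow_le_pow_left₀ (by positivity) h1 _
      _ ≤ (1 + α * M * ((2 * (ρ + r) + 1) ^ 2 : ℕ) * Real.exp (-(m * ((ρ : ℝ) - 2 * r)))) ^ M :=
          pow_le_pow_right₀ (le_add_of_nonneg_right (by positivity)) hM
  have hκQ2 : κQ < 1 / 2 := lt_of_le_of_lt hκQκ hκ
  have hκQ0 : 0 ≤ κQ := by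
    rw [hκQ, sub_nonneg]; exact one_le_pow₀ (le_add_of_nonneg_right (by positivity))
  have hl : (lS : ℝ) ≤ (ρ : ℝ) - 2 * r := by
    have : ((lS + 2 * r : ℕ) : ℝ) ≤ ρ := by exact_mod_cast hρl
    push_cast at this; linarith
  have key := poincareIneq_box_of_halves U β hR1 hR hN hδ0 hc hend hρr hρδ hwide hm.le hl hSMT' hκQ hκQ2 hg
    hTop hBot τ
  refine key.mono ?_
  have hN0 : (0 : ℝ) < N := by exact_mod_cast hN
  have hsq : Real.sqrt (κQ / (1 - κQ)) ≤ Real.sqrt (κ / (1 - κ)) :=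
    Real.sqrt_le_sqrt (div_one_sub_le_div_one_sub' hκQκ (by linarith))
  have h1 : (1 - Real.sqrt (κ / (1 - κ))) * g ≤ (1 - Real.sqrt (κQ / (1 - κQ))) * g :=
    mul_le_mul_of_nonneg_right (by linarith) hg
  rw [mul_div_assoc, mul_div_assoc]
  exact mul_le_mul_of_nonneg_right h1 (by positivity)

set_option maxHeartbeats 4000000 in
/-- **[Mar99] Theorem 4.5, the scale step (4.16)–(4.19) on fat rectangles**: see the module docstring.
Parameters at scale `L'`: `δ` (overlap width), `ρ` (`2r ≤ ρ`, `ρ + r ≤ δ`, `l + 2r ≤ ρ`), `N ≥ 1` strips with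
`12(Nδ + δ) ≤ L'`, `10(ρ+1) ≤ L'`, and `κ̄ < ½` the explicit error at volume `M = 4L'²`.  Conclusion: gap `≥ g`
on `𝓡_{L'}` (all boundary conditions) implies gap `≥ θ² g` on `𝓡_{L''}` whenever `3L'' ≤ 4L'`,
`θ = (1 − √(κ̄/(1−κ̄))) N/(N+1)`. [cite: Martinelli1999, Theorem 4.5, proof, (4.16)–(4.19)] -/
theorem fatRectangles_poincare_step {R : ℝ} (hR1 : 1 ≤ R)
    (hR : ∀ (Λ : Finset (Site 2)) (y : Site 2) (σ : Site 2 → ℤˣ),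
      R⁻¹ ≤ flipWeight U β Λ y σ ∧ flipWeight U β Λ y σ ≤ R)
    {lS : ℕ} {m : ℝ} (hm : 0 < m) (hSMT : ∀ L : ℕ, ∀ Q ∈ fatRectangles L, SMT (U.spec β) Q lS m)
    {L' δ N ρ : ℕ} (hN : 0 < N) (hδ0 : 0 < δ) (hρ2 : 2 * r ≤ ρ) (hρδ : ρ + r ≤ δ) (hρl : lS + 2 * r ≤ ρ)
    (hNδ : 12 * (N * δ + δ) ≤ L') (hρL : 10 * (ρ + 1) ≤ L') {κ : ℝ}
    (hκdef : κ = (1 + R ^ 6 * (2 * r + 1 : ℝ) ^ 2 * (2 * r + 1 : ℝ) ^ 2 * ((4 * L' ^ 2 : ℕ) : ℝ) *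
        ((2 * (ρ + r) + 1) ^ 2 : ℕ) * Real.exp (-(m * ((ρ : ℝ) - 2 * r)))) ^ (4 * L' ^ 2) - 1)
    (hκ : κ < 1 / 2) {g : ℝ} (hg : 0 ≤ g)
    (hPI : ∀ Q ∈ fatRectangles L', ∀ τ : Site 2 → ℤˣ, PoincareIneq (U.spec β Q τ) Q g)
    {L'' : ℕ} (hL2 : 3 * L'' ≤ 4 * L') :
    ∀ Q ∈ fatRectangles L'', ∀ τ : Site 2 → ℤˣ,
      PoincareIneq (U.spec β Q τ) Q (((1 - Real.sqrt (κ / (1 - κ))) * N / (N + 1)) ^ 2 * g) := by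
  classical
  set θ : ℝ := (1 - Real.sqrt (κ / (1 - κ))) * N / (N + 1) with hθ
  have hκ0 : 0 ≤ κ := by
    rw [hκdef, sub_nonneg]; exact one_le_pow₀ (le_add_of_nonneg_right (by positivity))
  have hN0 : (0 : ℝ) < N := by exact_mod_cast hN
  have hsqrt1 : Real.sqrt (κ / (1 - κ)) ≤ 1 := by
    rw [Real.sqrt_le_one, div_le_one (by linarith)]; linarith
  have hθ0 : 0 ≤ θ := by
    rw [hθ]
    have : 0 ≤ 1 - Real.sqrt (κ / (1 - κ)) := by linarith
    positivity
  have hθ1 : θ ≤ 1 := by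
    rw [hθ, div_le_one (by positivity)]
    have : (1 - Real.sqrt (κ / (1 - κ))) * N ≤ 1 * N :=
      mul_le_mul_of_nonneg_right (by linarith [Real.sqrt_nonneg (κ / (1 - κ))]) hN0.le
    linarith
  have hθg : θ * g ≤ g := by nlinarith
  have hθθg : θ ^ 2 * g ≤ θ * g := by nlinarith
  -- integer forms of the parameter inequalities
  have hNδ' : (12 : ℤ) * (N * δ + δ) ≤ L' := by exact_mod_cast hNδ
  have hρL' : (10 : ℤ) * (ρ + 1) ≤ L' := by exact_mod_cast hρL
  have hL3 : (3 : ℤ) * L'' ≤ 4 * L' := by exact_mod_cast hL2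
  have hδ0' : (0 : ℤ) < δ := by exact_mod_cast hδ0
  -- the halving step for a box, given the gap `g'` of its halves
  have halve : ∀ (a b : Site 2) (j : Fin 2) (g' : ℝ), 0 ≤ g' → (∀ i, a i < b i) →
      (L' : ℤ) < b j - a j → b j - a j ≤ L'' → (∀ i, i ≠ j → (ρ : ℤ) + 1 ≤ b i - a i) →
      (∀ i, b i - a i ≤ L'') →
      (∀ (a' b' : Site 2), (∀ i, i ≠ j → a' i = a i ∧ b' i = b i) → a j ≤ a' j → b' j ≤ b j →
        (b j - a j) / 2 - N * δ ≤ b' j - a' j → b' j - a' j ≤ (b j - a j) / 2 + N * δ + 1 →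
        ∀ φ : Site 2 → ℤˣ, PoincareIneq (U.spec β (Fintype.piFinset fun i => Finset.Ico ((a') i) ((b') i)) φ) (Fintype.piFinset fun i => Finset.Ico ((a') i) ((b') i)) g') →
      ∀ τ : Site 2 → ℤˣ, PoincareIneq (U.spec β (Fintype.piFinset fun i => Finset.Ico ((a) i) ((b) i)) τ) (Fintype.piFinset fun i => Finset.Ico ((a) i) ((b) i)) (θ * g') := by
    intro a b j g' hg' hpos hLj hjL2 hwide hall hhalves τ
    set ℓ := b j - a j with hℓ
    set c := a j + ℓ / 2 with hc
    have hℓ2 : ℓ / 2 ≤ ℓ - ℓ / 2 ∧ ℓ - ℓ / 2 ≤ ℓ / 2 + 1 ∧ 0 ≤ ℓ / 2 := by omega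
    have hcard : ((Fintype.piFinset fun i => Finset.Ico ((a) i) ((b) i))).card ≤ 4 * L' ^ 2 := by
      rw [card_IcoBox, Fin.prod_univ_two]
      have h0 : (b 0 - a 0).toNat ≤ 2 * L' := by have := hall 0; omega
      have h1 : (b 1 - a 1).toNat ≤ 2 * L' := by have := hall 1; omega
      calc (b 0 - a 0).toNat * (b 1 - a 1).toNat ≤ (2 * L') * (2 * L') := Nat.mul_le_mul h0 h1
        _ = 4 * L' ^ 2 := by ring
    have hcle : a j ≤ c := by rw [hc]; omega
    have hend : c + N * δ + δ ≤ b j := by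
      rw [hc]
      have : (N : ℤ) * δ + δ ≤ ℓ - ℓ / 2 := by nlinarith [hℓ2.1, hNδ', hLj]
      omega
    have hTop : ∀ n : ℕ, n < N → ∀ φ : Site 2 → ℤˣ,
        PoincareIneq (U.spec β (Fintype.piFinset fun i => Finset.Ico ((Function.update a j (c + n * δ)) i) ((b) i)) φ) (Fintype.piFinset fun i => Finset.Ico ((Function.update a j (c + n * δ)) i) ((b) i)) g' := by
      intro n hn φ
      have hn' : (n : ℤ) + 1 ≤ N := by exact_mod_cast hn
      have hnδ : (n : ℤ) * δ + δ ≤ N * δ := by nlinarith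
      have hnδ0 : (0 : ℤ) ≤ n * δ := by positivity
      refine hhalves _ _ (fun i hi => ⟨by rw [Function.update_of_ne hi], rfl⟩) ?_ le_rfl ?_ ?_ φ
      · rw [Function.update_self]; omega
      · rw [Function.update_self]; omega
      · rw [Function.update_self]; omega
    have hBot : ∀ n : ℕ, n < N → ∀ φ : Site 2 → ℤˣ,
        PoincareIneq (U.spec β (Fintype.piFinset fun i => Finset.Ico ((a) i) ((Function.update b j (c + n * δ + δ)) i)) φ)
          (Fintype.piFinset fun i => Finset.Ico ((a) i) ((Function.update b j (c + n * δ + δ)) i)) g' := by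
      intro n hn φ
      have hn' : (n : ℤ) + 1 ≤ N := by exact_mod_cast hn
      have hnδ : (n : ℤ) * δ + δ ≤ N * δ := by nlinarith
      have hnδ0 : (0 : ℤ) ≤ n * δ := by positivity
      refine hhalves _ _ (fun i hi => ⟨rfl, by rw [Function.update_of_ne hi]⟩) le_rfl ?_ ?_ ?_ φ
      · rw [Function.update_self]; omega
      · rw [Function.update_self]; omega
      · rw [Function.update_self]; omega
    have h := poincareIneq_box_of_halves_fat U β hR1 hR hm hSMT (a := a) (b := b) (j := j) (c := c) hN hδ0
      hcle hend hρ2 hρδ hρl hwide hcard hκdef hκ hg' hTop hBot τ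
    have e : (1 - Real.sqrt (κ / (1 - κ))) * g' * N / (N + 1) = θ * g' := by rw [hθ]; ring
    rwa [e] at h
  -- now the rectangles of `𝓡_{L''}`
  intro Q hQ τ
  obtain ⟨a, b, rfl, hpos, hfat, hle⟩ := exists_IcoBox_of_mem_fatRectangles hQ
  by_cases hsmall : ∀ i, b i - a i ≤ L'
  · -- already in `𝓡_{L'}`
    exact (hPI _ (IcoBox_mem_fatRectangles hpos hfat hsmall) τ).mono (hθθg.trans hθg)
  rw [not_forall] at hsmall
  obtain ⟨j₀, hj₀⟩ := hsmall
  rw [not_le] at hj₀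
  -- the longest side `j`
  obtain ⟨j, hlong, hLj⟩ : ∃ j : Fin 2, (∀ i, b i - a i ≤ b j - a j) ∧ (L' : ℤ) < b j - a j := by
    by_cases h01 : b 0 - a 0 ≤ b 1 - a 1
    · refine ⟨1, fun i => ?_, ?_⟩
      · fin_cases i
        · exact h01
        · exact le_rfl
      · fin_cases j₀
        · exact lt_of_lt_of_le hj₀ h01
        · exact hj₀
    · rw [not_le] at h01
      refine ⟨0, fun i => ?_, ?_⟩
      · fin_cases i
        · exact le_rfl
        · exact h01.le
      · fin_cases j₀
        · exact hj₀
        · exact lt_trans hj₀ h01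
  have hwide : ∀ i, i ≠ j → (ρ : ℤ) + 1 ≤ b i - a i := by
    intro i _
    have h1 := hfat j i
    nlinarith [hLj, hρL']
  -- the halves have gap `θ g` (case a): in `𝓡_{L'}`; case b): split once more along the other side)
  refine (halve a b j (θ * g) (mul_nonneg hθ0 hg) hpos hLj (hle j) hwide hle ?_ τ).mono (le_of_eq (by ring))
  intro a' b' hother ha' hb' hlow hupp φ
  -- sides of the half `H = Π[a'_i, b'_i)`
  have hℓ2 : (b j - a j) / 2 ≤ (b j - a j) - (b j - a j) / 2 ∧ 0 ≤ (b j - a j) / 2 ∧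
      2 * ((b j - a j) / 2) ≤ b j - a j ∧ b j - a j - 1 ≤ 2 * ((b j - a j) / 2) := by omega
  have hHj_le : b' j - a' j ≤ L' := by linarith [hupp, hle j, hL3, hNδ', hℓ2.2.2.1, hδ0']
  have hHj_ge : 5 * (b j - a j) ≤ 12 * (b' j - a' j) := by
    linarith [hlow, hNδ', hLj, hℓ2.2.2.2, hδ0']
  have hHside : ∀ i, i ≠ j → b' i - a' i = b i - a i := fun i hi => by rw [(hother i hi).1, (hother i hi).2]
  have hHpos : ∀ i, a' i < b' i := by
    intro i
    by_cases hi : i = j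
    · subst hi; nlinarith [hHj_ge, hLj]
    · rw [(hother i hi).1, (hother i hi).2]; exact hpos i
  have hHfat : ∀ i i', b' i - a' i ≤ 10 * (b' i' - a' i') := by
    intro i i'
    by_cases hi : i = j <;> by_cases hi' : i' = j
    · rw [hi, hi']; linarith [hHj_ge, hLj]
    · rw [hi, hHside i' hi']
      have := hfat j i'
      linarith [hupp, hℓ2.2.2.1, hNδ', hLj, hδ0', hρL']
    · rw [hi', hHside i hi]
      linarith [hlong i, hHj_ge]
    · rw [hHside i hi, hHside i' hi']; exact hfat i i'
  by_cases hcase : ∀ i, i ≠ j → b i - a i ≤ L'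
  · -- case a): the half lies in `𝓡_{L'}`
    have hHle : ∀ i, b' i - a' i ≤ L' := by
      intro i
      by_cases hi : i = j
      · subst hi; exact hHj_le
      · rw [hHside i hi]; exact hcase i hi
    exact (hPI _ (IcoBox_mem_fatRectangles hHpos hHfat hHle) φ).mono hθg
  · -- case b): the other side `i` is longer than `L'`; split the half along `i`
    rw [not_forall] at hcase
    obtain ⟨i, hi⟩ := hcase
    rw [Classical.not_imp, not_le] at hi
    obtain ⟨hij, hLi⟩ := hi
    have hother_eq : ∀ i' : Fin 2, i' ≠ i → i' = j := by
      intro i' hi'i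
      have h1 := Fin.val_ne_of_ne hi'i
      have h2 := Fin.val_ne_of_ne hij
      apply Fin.ext
      have := i.isLt; have := j.isLt; have := i'.isLt
      omega
    have hHlong_i : (L' : ℤ) < b' i - a' i := by rw [hHside i hij]; exact hLi
    have hHall : ∀ i', b' i' - a' i' ≤ L'' := by
      intro i'
      by_cases hi' : i' = j
      · rw [hi']; linarith [hupp, hle j, hℓ2.2.2.1, hNδ', hLj, hδ0']
      · rw [hHside i' hi']; exact hle i'
    have hHwide : ∀ i', i' ≠ i → (ρ : ℤ) + 1 ≤ b' i' - a' i' := by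
      intro i' hi'i
      rw [hother_eq i' hi'i]
      nlinarith [hHj_ge, hLj, hρL']
    refine halve a' b' i g hg hHpos hHlong_i (hHall i) hHwide hHall ?_ φ
    -- the quarters lie in `𝓡_{L'}`
    intro a'' b'' hother' ha'' hb'' hlow' hupp' ψ
    have hℓi2 : (b' i - a' i) / 2 ≤ (b' i - a' i) - (b' i - a' i) / 2 ∧ 0 ≤ (b' i - a' i) / 2 ∧
        2 * ((b' i - a' i) / 2) ≤ b' i - a' i ∧ b' i - a' i - 1 ≤ 2 * ((b' i - a' i) / 2) := by omega
    have hKi_le : b'' i - a'' i ≤ L' := by linarith [hupp', hHall i, hL3, hNδ', hℓi2.2.2.1, hδ0']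
    have hKi_ge : 5 * (b' i - a' i) ≤ 12 * (b'' i - a'' i) := by
      linarith [hlow', hNδ', hHlong_i, hℓi2.2.2.2, hδ0']
    have hKside : ∀ i', i' ≠ i → b'' i' - a'' i' = b' i' - a' i' := fun i' hi' => by
      rw [(hother' i' hi').1, (hother' i' hi').2]
    have hKpos : ∀ i', a'' i' < b'' i' := by
      intro i'
      by_cases hi' : i' = i
      · subst hi'; nlinarith [hKi_ge, hHlong_i]
      · rw [(hother' i' hi').1, (hother' i' hi').2]; exact hHpos i'
    have hKle : ∀ i', b'' i' - a'' i' ≤ L' := by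
      intro i'
      by_cases hi' : i' = i
      · subst hi'; exact hKi_le
      · rw [hKside i' hi', hother_eq i' hi']; exact hHj_le
    have hlowb : ∀ i', 5 * (L' : ℤ) ≤ 12 * (b'' i' - a'' i') := by
      intro i'
      by_cases hi' : i' = i
      · subst hi'; nlinarith [hKi_ge, hHlong_i]
      · rw [hKside i' hi', hother_eq i' hi']; nlinarith [hHj_ge, hLj]
    have hKfat : ∀ i₁ i₂, b'' i₁ - a'' i₁ ≤ 10 * (b'' i₂ - a'' i₂) := by
      intro i₁ i₂
      nlinarith [hlowb i₂, hKle i₁]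
    exact hPI _ (IcoBox_mem_fatRectangles hKpos hKfat hKle) ψ

end Glauber

end Literature.Probability.LatticeModels

end
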